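import Summits.CriticalPhenomena.PercolationContinuityZ3.Theorems.PercNearOneGluingNoHeavyLowerTailSahiE3JuntaMeetSmall
import HarnessLib

/-!
# `NoHeavyLowerTail` (crux stmt-CriticalPhenomena-4575), Sahi programme P4: Sahi's `E₃ ≥ 0` in every dimension whenever a pairwise
# intersection depends on at most FOUR coordinates (computational: rests on the `native_decide` certificate `…SahiC3CubeFour`)

Support file (cell `prim-l12`, seat P4, generation 3; `--supports stmt-CriticalPhenomena-4575`, computational).  The `|W| ≤ 4` versions
of `…SahiE3JuntaMeetSmall`: the transfer theorem `sahiE3_nonneg_of_mul_junta_of_block` composed, through the `ED` ↔ `prodBernoulli`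
bridge `ED_sahiE3_eq`, with the Sahi cell's `SahiC3Cube.sahiC3_of_card_le_four` (kernel for `≤ 3`, `native_decide` for the 4-cube —
hence the extra compiler axiom of that certificate in the closure of the two theorems below).  [this work]
-/

noncomputable section

open Classical

namespace Summit.CriticalPhenomena.PercolationContinuityZ3.Theorems

namespace SahiE3JuntaMeet

open Finset MeasureTheory Literature.Probability.Percolation Literature.Probability.Percolation.DecisionTree
  Literature.Probability.LatticeModels SahiE3PrincipalMeet

variable {ι : Type*}

/-- **Sahi's inequality in `ED` form on every block of at most four coordinates** (the Sahi cell's computational certificate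
`…SahiC3CubeFour`, `native_decide`). [this work; from `SahiC3Cube.sahiC3_of_card_le_four`] -/
theorem ED_sahiE3_nonneg_of_card_le_four [DecidableEq ι] (W : Finset ι) (hW : W.card ≤ 4) {p : ι → ℝ}
    (hp0 : ∀ i, 0 ≤ p i) (hp1 : ∀ i, p i ≤ 1) {t f g : Finset ι → ℝ}
    (ht : ∀ ⦃S T : Finset ι⦄, S ⊆ T → t S ≤ t T) (ht01 : ∀ S, t S = 0 ∨ t S = 1)
    (hf : ∀ ⦃S T : Finset ι⦄, S ⊆ T → f S ≤ f T) (hf01 : ∀ S, f S = 0 ∨ f S = 1)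
    (hg : ∀ ⦃S T : Finset ι⦄, S ⊆ T → g S ≤ g T) (hg01 : ∀ S, g S = 0 ∨ g S = 1) :
    0 ≤ 2 * ED W p (fun S => t S * f S * g S) + ED W p t * ED W p f * ED W p g - ED W p t * ED W p (fun S => f S * g S)
        - ED W p f * ED W p (fun S => t S * g S) - ED W p g * ED W p (fun S => t S * f S) := by
  rw [ED_sahiE3_eq W hp0 hp1 ht01 hf01 hg01]
  have hcard : Fintype.card ↥W ≤ 4 := by rw [Fintype.card_coe]; exact hW
  exact SahiC3Cube.sahiC3_of_card_le_four hcard _ (isUpperSet_blockEvent W ht ht01) (isUpperSet_blockEvent W hf hf01)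
    (isUpperSet_blockEvent W hg hg01)

/-- **Sahi's `E₃ ≥ 0` whenever `A ∩ B` depends on at most four coordinates — in every dimension** (rests on the Sahi cell's
`native_decide` certificate for the 4-cube).  Same statement with `|W| ≤ 4`.  [this work] -/
theorem sahiE3_nonneg_of_mul_junta_card_le_four [DecidableEq ι] (W D : Finset ι) (hWD : Disjoint W D) (hW : W.card ≤ 4)
    {p : ι → ℝ} (hp0 : ∀ i, 0 ≤ p i) (hp1 : ∀ i, p i ≤ 1) {u f g : Finset ι → ℝ}
    (hu : ∀ ⦃S T : Finset ι⦄, S ⊆ T → u S ≤ u T) (hu01 : ∀ S, u S = 0 ∨ u S = 1)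
    (hf : ∀ ⦃S T : Finset ι⦄, S ⊆ T → f S ≤ f T) (hf01 : ∀ S, f S = 0 ∨ f S = 1)
    (hg : ∀ ⦃S T : Finset ι⦄, S ⊆ T → g S ≤ g T) (hg01 : ∀ S, g S = 0 ∨ g S = 1)
    (hfg : ∀ Z, Z ⊆ D → ∀ T, T ⊆ W → f (Z ∪ T) * g (Z ∪ T) = f (D ∪ T) * g (D ∪ T)) :
    0 ≤ 2 * ED (W ∪ D) p (fun S => u S * f S * g S)
          + ED (W ∪ D) p u * ED (W ∪ D) p f * ED (W ∪ D) p g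
          - ED (W ∪ D) p u * ED (W ∪ D) p (fun S => f S * g S)
          - ED (W ∪ D) p f * ED (W ∪ D) p (fun S => u S * g S)
          - ED (W ∪ D) p g * ED (W ∪ D) p (fun S => u S * f S) :=
  sahiE3_nonneg_of_mul_junta_of_block W D hWD hp0 hp1 hu hu01 hf hf01 hg hg01 hfg fun _ ht ht01 =>
    ED_sahiE3_nonneg_of_card_le_four W hW hp0 hp1 ht ht01
      (fun _ _ hST => hf (Finset.union_subset_union (Finset.Subset.refl D) hST)) (fun _ => hf01 _)
      (fun _ _ hST => hg (Finset.union_subset_union (Finset.Subset.refl D) hST)) (fun _ => hg01 _)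

end SahiE3JuntaMeet

end Summit.CriticalPhenomena.PercolationContinuityZ3.Theorems

end
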